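import Summits.HodgeConjecture.HodgeConjecture.Theorems.EightfoldBlochSeedsChernCharacterOnBettiAnalytificationAdditive
import Summits.HodgeConjecture.HodgeConjecture.Theorems.EightfoldBlochSeedsChernCharacterOnBettiAnalytificationLineBundle
import Literature.AlgebraicGeometry.HodgeTheory.DivisorCupRaisesGeometricConiveau
import HarnessLib

/-!
# K1 → cycle law `ch_mem_algebraicClasses` for vector bundles WITH A FULL FLAG (all degrees)

Route `EightfoldBlochSeeds` / item `stmt-HodgeConjecture-19780` (`ChernCharacterOnBetti`), helper
(`--supports`). HONEST FRAMING: nothing here proves 19780 / 18880 / 18882 / 18883 / H2 / HC_AV / HC;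
no definition, no named fact.

WHAT. On a smooth projective complex variety `X`, for every `𝒪_X`-module `F` with a FULL FLAG
(`Motives.HasFullFlag F`: a successive extension of modules of rank `≤ 1` — e.g. every line bundle,
every split bundle, and `f^*E` for the flag variety `f : Fl(E) → X` of any vector bundle `E`) and every
topological analytification datum `(E, α)` of `F` (steps K1a–K1d), ALL components of the topological
Chern character are algebraic classes:

  `ch_k(E) = theChernClassTheory.topologicalChernCharacter ℂ E k ∈ algebraicClasses X k = Nᵏ H²ᵏ(X(ℂ); ℂ)`

(`topologicalChernCharacter_mem_algebraicClasses_of_comparison_of_hasFullFlag`). This is the field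
`ch_mem_algebraicClasses` of `HodgeTheory.ChernCharacterBetti` for flagged bundles — by Grothendieck's
splitting principle (the tree's named fact `HodgeTheory.SplittingPrincipleBetti`, Grothendieck 1958 §2)
the general vector bundle reduces to this case up to the descent of coniveau along `Fl(E) → X`.
Proof, by induction on the flag:
* rank `≤ 1` (`topologicalChernCharacter_mem_algebraicClasses_of_comparison_of_rank_le_one`):
  `ch_k(L) = c₁(L)ᵏ/k!` (`topologicalChernCharacter_eq_cupPowTwo_of_rank_le_one`, K1), `c₁(L)` is a
  divisor class (`…_one_mem_algebraicClasses_of_comparison`, K1c) and cup product with a divisor class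
  raises the geometric coniveau by one UNCONDITIONALLY (Voisin 2025 §4.3 / Deligne Hodge III 8.2.8, the
  tree's `cupProduct_mem_supportedClasses_succ_of_mem_algebraicClasses_one_right`), so `c₁(L)ᵏ ∈ Nᵏ`
  (`cupPowTwo_mem_algebraicClasses`);
* the zero module: `ch_k(E) = ch_k(E) + ch_k(E)` by additivity on `0 → F → F → F → 0` (K1f,
  `topologicalChernCharacter_eq_add_of_comparison_shortExact`), so `ch_k(E) = 0`;
* an extension `0 → F₁ → F → L → 0` with `F₁` flagged and `rank L ≤ 1`: analytification data of `F₁`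
  and `L` exist (`exists_topologicalAnalytification_of_isVectorBundle / _of_hasRankLE`, K1d), additivity
  (K1f) gives `ch_k(E) = ch_k(E₁) + ch_k(E_L)`, and both summands are algebraic (induction, rank `≤ 1`).

[cite: Fulton1998, Example 3.2.3, §15.1 and Prop. 19.1.2] [cite: Grothendieck1958, §2]
[cite: Voisin2025, §4.1 Example 4.2 and §4.3] [cite: SerreGAGA1956, §3 n°9 Prop. 10]
-/

noncomputable section

-- single-problem summit (Problem = Summit): the mandated namespace repeats `HodgeConjecture`.
set_option linter.dupNamespace false

open CategoryTheory AlgebraicGeometry Bundle Topology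
open Literature.AlgebraicGeometry.Motives Literature.AlgebraicGeometry.HodgeTheory Literature.AlgebraicGeometry.Modules
open Literature.AlgebraicTopology.SingularHomology Literature.AlgebraicTopology.CharacteristicClasses

namespace Summit.HodgeConjecture.HodgeConjecture.Theorems

variable {n : ℕ} {X : SchemeOver ℂ}

/-- **Powers of a divisor class are algebraic**: `x ∈ N¹ H²(X(ℂ); ℂ)` implies `xᵏ ∈ Nᵏ H²ᵏ(X(ℂ); ℂ)`
(cup product with a divisor class raises the geometric coniveau by one, Voisin 2025 §4.3 — the tree's
`cupProduct_mem_supportedClasses_succ_of_mem_algebraicClasses_one_right`; `x⁰ = 1 ∈ N⁰ = H⁰`).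
[cite: Voisin2025, §4.1 Example 4.2 and §4.3] -/
theorem cupPowTwo_mem_algebraicClasses (hX : IsSmoothProjective n X) {x : complexBetti X 2}
    (hx : x ∈ algebraicClasses X 1) : ∀ k : ℕ, cupPowTwo x k ∈ algebraicClasses X k
  | 0 => by
    change cupPowTwo x 0 ∈ supportedClasses X (2 * 0) 0
    rw [supportedClasses_zero]
    exact Submodule.mem_top
  | k + 1 => by
    rw [cupPowTwo_succ]
    exact cupProduct_mem_supportedClasses_succ_of_mem_algebraicClasses_one_right hX (two_mul_add_two k)
      (cupPowTwo_mem_algebraicClasses hX hx k) hx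

variable {F : X.left.Modules} {r : ℕ}

/-- **`ch_k` of an analytification of rank `≤ 1` is algebraic, in every degree**: `ch_k(L) = c₁(L)ᵏ/k!`
with `c₁(L)` a divisor class. [cite: Fulton1998, §15.1 (iii) and Prop. 19.1.2]
[cite: Voisin2025, §4.1 Example 4.2 and §4.3] -/
theorem topologicalChernCharacter_mem_algebraicClasses_of_comparison_of_rank_le_one (hX : IsSmoothProjective n X)
    (hF : ∀ x : X.left, ∃ (U : X.left.Opens) (s : Fin r → Γ(F, U)), x ∈ U ∧ IsSectionFrame F U s)
    (E : ComplexVectorBundle.{0, 0} (ComplexPoints X)) (hE : E.rank ≤ 1)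
    (α : ∀ U : X.left.Opens, Γ(F, U) → ∀ P : ComplexPoints X, E.E P)
    (hcont : ∀ (U : X.left.Opens) (σ : Γ(F, U)),
      ContinuousOn (fun P ↦ (⟨P, α U σ P⟩ : TotalSpace E.F E.E)) {P | P.pt ∈ U})
    (hframe : ∀ (U : X.left.Opens) (t : Fin r → Γ(F, U)), IsSectionFrame F U t →
      ∀ P : ComplexPoints X, P.pt ∈ U → LinearIndependent ℂ (fun j ↦ α U (t j) P) ∧
        ⊤ ≤ Submodule.span ℂ (Set.range fun j ↦ α U (t j) P)) (k : ℕ) :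
    theChernClassTheory.topologicalChernCharacter ℂ E k ∈ algebraicClasses X k := by
  rcases isEmpty_or_nonempty X.left with hX0 | ⟨⟨x₀⟩⟩
  · haveI : IsEmpty (ComplexPoints X) := ⟨fun P ↦ hX0.elim P.pt⟩
    haveI := ModuleCat.subsingleton_of_isZero (isZero_singularCohomology_of_isEmpty' ℂ (ComplexPoints X) (2 * k))
    rw [Subsingleton.elim (theChernClassTheory.topologicalChernCharacter ℂ E k) 0]
    exact Submodule.zero_mem _
  obtain ⟨U, t, hxU, ht⟩ := hF x₀
  have h1 : theChernClassTheory.topologicalChernCharacter ℂ E 1 ∈ algebraicClasses X 1 :=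
    topologicalChernCharacter_one_mem_algebraicClasses_of_comparison hX E α hcont hframe ⟨x₀, hxU⟩ ht
  rcases Nat.eq_zero_or_pos k with rfl | hk
  · change _ ∈ supportedClasses X (2 * 0) 0
    rw [supportedClasses_zero]
    exact Submodule.mem_top
  · rw [topologicalChernCharacter_eq_cupPowTwo_of_rank_le_one E hE hk]
    exact Submodule.smul_mem _ _ (cupPowTwo_mem_algebraicClasses hX h1 k)

/-- **`ch_mem_algebraicClasses` for modules with a full flag, every degree.** For `X` smooth projective
over `ℂ`, `F` an `𝒪_X`-module with a full flag and `(E, α)` any topological analytification datum of `F`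
(frames of size `r` near every point): `ch_k(E) ∈ algebraicClasses X k` for all `k` (induction on the
flag through the additivity of `ch` on short exact sequences and the rank-`≤ 1` case).
[cite: Fulton1998, Example 3.2.3, §15.1 and Prop. 19.1.2] [cite: Grothendieck1958, §2]
[cite: Voisin2025, §4.3] [cite: SerreGAGA1956, §3 n°9 Prop. 10] -/
theorem topologicalChernCharacter_mem_algebraicClasses_of_comparison_of_hasFullFlag (hX : IsSmoothProjective n X)
    (hflag : HasFullFlag F)
    (hF : ∀ x : X.left, ∃ (U : X.left.Opens) (s : Fin r → Γ(F, U)), x ∈ U ∧ IsSectionFrame F U s)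
    (E : ComplexVectorBundle.{0, 0} (ComplexPoints X))
    (α : ∀ U : X.left.Opens, Γ(F, U) → ∀ P : ComplexPoints X, E.E P)
    (hadd : ∀ (U : X.left.Opens) (σ τ : Γ(F, U)) (P : ComplexPoints X), α U (σ + τ) P = α U σ P + α U τ P)
    (hsmul : ∀ (U : X.left.Opens) (f : Γ(X.left, U)) (σ : Γ(F, U)) (P : ComplexPoints X) (h : P.pt ∈ U),
      α U (f • σ) P = P.eval U h f • α U σ P)
    (hres : ∀ (U W : X.left.Opens) (hWU : W ≤ U) (σ : Γ(F, U)) (P : ComplexPoints X), P.pt ∈ W →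
      α W (F.presheaf.map (homOfLE hWU).op σ) P = α U σ P)
    (hcont : ∀ (U : X.left.Opens) (σ : Γ(F, U)),
      ContinuousOn (fun P ↦ (⟨P, α U σ P⟩ : TotalSpace E.F E.E)) {P | P.pt ∈ U})
    (hframe : ∀ (U : X.left.Opens) (t : Fin r → Γ(F, U)), IsSectionFrame F U t →
      ∀ P : ComplexPoints X, P.pt ∈ U → LinearIndependent ℂ (fun j ↦ α U (t j) P) ∧
        ⊤ ≤ Submodule.span ℂ (Set.range fun j ↦ α U (t j) P)) (k : ℕ) :
    theChernClassTheory.topologicalChernCharacter ℂ E k ∈ algebraicClasses X k := by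
  induction hflag generalizing r E with
  | of_isZero F hF0 =>
    -- `0 → F → F → F → 0` is short exact, so `ch_k(E) = ch_k(E) + ch_k(E)` and `ch_k(E) = 0`
    have hfl : IsFiniteLocallyFree F := (hasRankLE_zero_of_isZero hF0).isFiniteLocallyFree
    let S : ShortComplex X.left.Modules := ShortComplex.mk (𝟙 F) (𝟙 F) (hF0.eq_of_src _ _)
    have hS : S.ShortExact :=
      ShortComplex.ShortExact.mk' (S.exact_of_isZero_X₂ hF0) inferInstance inferInstance
    have h := topologicalChernCharacter_eq_add_of_comparison_shortExact (S := S) hX hS hfl hfl hF hF hF E E E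
      α α α hadd hsmul hres hcont hframe hadd hsmul hres hcont hframe hadd hsmul hres hcont hframe k
    have h0 : theChernClassTheory.topologicalChernCharacter ℂ E k = 0 := by
      have h' : theChernClassTheory.topologicalChernCharacter ℂ E k + theChernClassTheory.topologicalChernCharacter ℂ E k =
          theChernClassTheory.topologicalChernCharacter ℂ E k + 0 := by rw [add_zero]; exact h.symm
      exact add_left_cancel h'
    rw [h0]
    exact Submodule.zero_mem _
  | of_shortExact S hS h₁ h₃ ih =>
    -- data for the flagged kernel and the rank `≤ 1` quotient
    have hV₁ : IsVectorBundle S.X₁ := h₁.isFiniteLocallyFree.isVectorBundle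
    obtain ⟨r₁, E₁, α₁, -, hF₁, hadd₁, hsmul₁, hres₁, hcont₁, hframe₁⟩ :=
      exists_topologicalAnalytification_of_isVectorBundle hX hV₁
    obtain ⟨r₃, E₃, α₃, hr₃, hrank₃, hF₃, hadd₃, hsmul₃, hres₃, hcont₃, hframe₃⟩ :=
      exists_topologicalAnalytification_of_hasRankLE hX h₃
    have hadd' := topologicalChernCharacter_eq_add_of_comparison_shortExact hX hS h₁.isFiniteLocallyFree
      h₃.isFiniteLocallyFree hF₁ hF hF₃ E₁ E E₃ α₁ α α₃ hadd₁ hsmul₁ hres₁ hcont₁ hframe₁ hadd hsmul hres hcont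
      hframe hadd₃ hsmul₃ hres₃ hcont₃ hframe₃ k
    rw [hadd']
    refine Submodule.add_mem _ (ih hF₁ E₁ α₁ hadd₁ hsmul₁ hres₁ hcont₁ hframe₁) ?_
    exact topologicalChernCharacter_mem_algebraicClasses_of_comparison_of_rank_le_one hX hF₃ E₃
      (by rw [hrank₃]; exact hr₃) α₃ hcont₃ hframe₃ k

end Summit.HodgeConjecture.HodgeConjecture.Theorems

end
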